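import Literature.AlgebraicGeometry.Limits.SubalgebraEndomorphismRingSpread
import Literature.AlgebraicGeometry.HodgeTheory.SpreadingOutQbarFamilyProofs
import Literature.AlgebraicGeometry.Motives.AbelianVarietyProjectiveChart
import Literature.AlgebraicGeometry.AbelianSchemes.AbelianSchemeFibreEndomorphisms
import HarnessLib

/-!
# An abelian variety over a field `K ⊇ k` (`k` perfect) spreads out to an abelian scheme over a finitely generated
# `k`-subalgebra of `K` (EGA IV₃ 8.8.2, 8.10.5, IV₄ 17.7.8; Milne, *Abelian Varieties* §20 Rem. 20.9)

Topic `Literature/AlgebraicGeometry/AbelianSchemes`; namespace `Literature.AlgebraicGeometry.AbelianSchemes.AbelianScheme`.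
Cell `hodgecm-mathlib` (D-0151), row III-0 (`Liu2021.albanese_bettiOne_pullback_bijective`), A-p14's road memo
`ROAD-III0-albanese-baseChange.md` / `SPEC-III0-pieces.md`, piece **F2**: the TEMPLATE is
`AbelianSchemes/AbelianSchemeRingActionSpread.lean` (A-p14: `exists_abelianScheme_relDim_ringAction_fibre_iso`, over
`ℚ̄ = algebraicClosure ℚ ℂ ⊆ ℂ`, with an action of an order) with THREE EDITS — (1) `ℚ̄ ⊆ ℂ` is replaced by an arbitrary
perfect field `k` and an arbitrary field extension `K` of `k` (the engine `HodgeTheory.SpreadingOutQbar.exists_smooth_projective_spread`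
is already stated in that generality); (2) the ring action is DROPPED: the group law alone descends to a stage, by
`Limits.SubalgGrpSpread.exists_grpSpread` + `GrpSpread.grpObj` / `isCommMonObj` / `isMonHom_legFacObjIso_hom`; (3) the
relative dimension `IsOfRelDim (dim A)` and the fibre isomorphism `𝒜_ψ ≅ A` are kept.  THEOREMS ONLY (no definition, no
named fact, no instance; net debt 0).

THE PRINT.  [Milne1986AbelianVarieties] §20, Rem. 20.9 / proof of Cor. 20.4: «`A` is defined over a subfield finitely
generated over the prime field»; [EGAIV3] Thm. 8.8.2 (morphisms and their identities descend to a stage of `Spec K = lim Spec T[t]`),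
Thm. 8.10.5 (properness descends), [EGAIV4] 17.7.8 (smoothness descends) — all PROVED in the tree and only ASSEMBLED here:
* the underlying smooth projective variety spreads out: `HodgeTheory.SpreadingOutQbar.exists_smooth_projective_spread` (over a
  finitely generated `k`-domain `T ⊆ K`, proper, smooth of relative dimension `dim A`, geometrically irreducible fibres,
  `A ≅ Y ×_T Spec K`);
* the (commutative) group law descends to a stage `T′ = T[t] ⊆ K` of the subalgebra diagram `Spec K = lim Spec T[t]`:
  `Limits.SubalgGrpSpread.exists_grpSpread`, `GrpSpread.grpObj`, `GrpSpread.isCommMonObj`, `GrpSpread.isMonHom_legFacObjIso_hom`;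
* packaging: the stage is an `AbelianScheme T′` (`AbelianSchemes/AbelianSchemeAffineBase`) of relative dimension `dim A`
  (`IsOfRelDim`, stable under base change), and its fibre along `ψ : T′ ↪ K` (`AbelianScheme.fibre`) is `A`.

RESULT `exists_abelianScheme_relDim_fibre_iso`: for `A : AbelianVariety K` there are a finitely generated `k`-DOMAIN `T′` with
an INJECTIVE `k`-algebra map `ψ : T′ → K`, an abelian scheme `𝒜/T′` with commutative group law, of relative dimension `dim A`, and
an isomorphism of abelian varieties `𝒜_ψ ≅ A` over `K`.  Consumer: A-p14's F3/F5 (spread of the Abel–Jacobi morphism, the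
dimension inequality `dim J(Y_ℂ) ≤ dim J(Y_k)`).  HC_CM is proved only modulo the 7 printed citations until rung 0 closes.

## References
* [EGAIV3] A. Grothendieck, EGA IV₃ (Publ. Math. IHÉS 28, 1966), Thm. 8.8.2, Thm. 8.10.5.
* [Milne1986AbelianVarieties] J. S. Milne, *Abelian Varieties* (1986), §20, Rem. 20.9.
* [MilneCM2006] J. S. Milne, *Complex Multiplication* (2006), Prop. 7.10 and its proof (the same spreading step).
-/

set_option autoImplicit false

noncomputable section

open CategoryTheory CategoryTheory.Limits AlgebraicGeometry MonoidalCategory CartesianMonoidalCategory MonObj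

universe u

namespace Literature.AlgebraicGeometry.AbelianSchemes.AbelianScheme

open Literature.AlgebraicGeometry.Motives
open Literature.AlgebraicGeometry.Limits Literature.AlgebraicGeometry.Limits.SubalgApprox
  Literature.AlgebraicGeometry.Limits.SubalgGrpSpread
open Literature.AlgebraicGeometry.HodgeTheory

set_option backward.isDefEq.respectTransparency false

/-! ## §1 Two small transports -/

/-- Geometrically irreducible morphisms are geometrically connected. [folklore] -/
private theorem geometricallyConnected_of_geometricallyIrreducible' {X Y : Scheme.{u}} (f : X ⟶ Y)
    [h : GeometricallyIrreducible f] : GeometricallyConnected f :=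
  ⟨fun _ _ y _ fst snd hpb => by
    haveI : IrreducibleSpace _ := h.geometrically_irreducibleSpace y fst snd hpb
    infer_instance⟩

universe v' u' in
/-- Transport of commutativity of a monoid object along `MonObj.ofIso`. [folklore] -/
private theorem isCommMonObj_ofIso'' {C : Type u'} [Category.{v'} C] [MonoidalCategory C] [BraidedCategory C]
    {M X : C} [MonObj M] [IsCommMonObj M] (e : M ≅ X) : letI := MonObj.ofIso e; IsCommMonObj X := by
  letI := MonObj.ofIso e
  refine { mul_comm := ?_ }
  rw [MonObj.ofIso_mul, ← Category.assoc, ← BraidedCategory.braiding_naturality, Category.assoc,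
    IsCommMonObj.mul_comm_assoc]

/-! ## §2 The spread of `A` as an abelian scheme over a finitely generated `k`-subalgebra of `K` -/

/-- **Spreading out an abelian variety over a field extension `K ⊇ k`, `k` perfect** (Milne, *Abelian Varieties* §20
Rem. 20.9: «`A` is defined over a subfield finitely generated over the prime field»; EGA IV₃ 8.8.2 / 8.10.5, IV₄ 17.7.8).
For `A : AbelianVariety K` there are: a finitely generated `k`-algebra `T′` which is a domain, with an INJECTIVE `k`-algebra
map `ψ : T′ → K`; an abelian scheme `𝒜` over `T′` whose group law is commutative and which is of relative dimension `dim A`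
(`AbelianScheme.IsOfRelDim`); and an isomorphism of abelian varieties `𝒜_ψ ≅ A` over `K` (the fibre of `𝒜` along `ψ`,
`AbelianScheme.fibre`).  Construction: the smooth projective spread `Y → Spec T` of the variety `A`
(`exists_smooth_projective_spread`), then descent of the group law to a stage `T′ = T[t]` of `Spec K = lim_t Spec T[t]`
(`exists_grpSpread`, `GrpSpread.grpObj`); the template is `exists_abelianScheme_relDim_ringAction_fibre_iso` (ring action dropped,
`ℚ̄ ⊆ ℂ` generalised). [cite: EGAIV3, Thm. 8.8.2 and Thm. 8.10.5] [cite: Milne1986AbelianVarieties, §20 Rem. 20.9]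
[cite: MilneCM2006, Prop. 7.10 (proof)] -/
theorem exists_abelianScheme_relDim_fibre_iso {k : Type u} [Field k] [PerfectField k] {K : Type u} [Field K]
    [Algebra k K] (A : AbelianVariety K) :
    ∃ (T' : Type u) (_ : CommRing T') (_ : IsDomain T') (_ : Algebra k T') (_ : Algebra.FiniteType k T')
      (ψ : T' →ₐ[k] K) (_ : Function.Injective ψ) (𝒜 : AbelianScheme T'),
      IsCommMonObj 𝒜.X ∧ 𝒜.IsOfRelDim A.dim ∧ Nonempty (𝒜.fibre ψ.toRingHom ≅ A) := by
  classical
  -- `k ⊆ K` and the smooth projective spread of the underlying variety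
  obtain ⟨T, _, _, _, _, ψ₀, hψ₀, hinj, N, Y, g, emb, _, π, -, -, hpr, hsm, hgi, hpb⟩ :=
    SpreadingOutQbar.exists_smooth_projective_spread (k := k) (K := K)
      (AbelianVariety.isSmoothProjective_holds (A := A))
  letI : Algebra T K := ψ₀.toAlgebra
  haveI : IsScalarTower k T K :=
    IsScalarTower.of_algebraMap_eq fun x => (RingHom.congr_fun hψ₀ x).symm
  -- the model as a `T`-scheme
  let P : SchemeOver T := Over.mk g
  haveI : IsProper P.hom := hpr
  haveI := hsm
  haveI : Smooth P.hom := SmoothOfRelativeDimension.smooth A.dim g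
  haveI : GeometricallyIrreducible P.hom := hgi
  haveI : QuasiCompact P.hom := inferInstance
  haveI : IsSeparated P.hom := inferInstance
  haveI : QuasiSeparated P.hom := inferInstance
  haveI : Flat P.hom := inferInstance
  haveI : LocallyOfFinitePresentation P.hom := inferInstance
  -- `A ≅ Y ×_T Spec K` as `K`-schemes (both viewed in the category `Over (Spec K)` of the limit `Spec K = lim Spec T[t]`);
  -- the transported (commutative) group law on `Y ×_T Spec K`
  let XA : Over (specOver T K).left := A.X
  letI : GrpObj XA := A.grpObj
  haveI : IsCommMonObj XA := AbelianVariety.instIsCommMonObj A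
  let e₁ : XA ≅ limObj K P := Over.isoMk hpb.isoPullback hpb.isoPullback_hom_snd
  letI : GrpObj (limObj K P) := GrpObj.ofIso e₁
  haveI : IsCommMonObj (limObj K P) := isCommMonObj_ofIso'' e₁
  haveI : IsMonHom e₁.hom := isMonHom_ofIso e₁
  haveI : IsMonHom e₁.inv := inferInstance
  -- descent of the group law to a stage
  obtain ⟨t₁, ⟨d⟩⟩ := exists_grpSpread K (∅ : Finset K) P
  haveI : Flat (stageObj K ∅ P t₁).hom :=
    inferInstanceAs (Flat (pullback.snd P.hom ((baseDiagram T K ∅).obj t₁).hom))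
  haveI : IsSeparated (stageObj K ∅ P t₁).hom :=
    inferInstanceAs (IsSeparated (pullback.snd P.hom ((baseDiagram T K ∅).obj t₁).hom))
  -- the stage `T′ = T[t₁] ⊆ K` and the abelian scheme
  letI : GrpObj (stageObj K ∅ P t₁) := d.grpObj
  have hcomm : IsCommMonObj (stageObj K ∅ P t₁) := d.isCommMonObj
  have hiso := d.isMonHom_legFacObjIso_hom
  let 𝒜 : AbelianScheme ↥(sub T K t₁.unop.1) :=
    { X := stageObj K ∅ P t₁
      isProper := inferInstanceAs (IsProper (pullback.snd P.hom ((baseDiagram T K ∅).obj t₁).hom))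
      isSmooth := inferInstanceAs (Smooth (pullback.snd P.hom ((baseDiagram T K ∅).obj t₁).hom))
      geometricallyConnected := by
        haveI : GeometricallyIrreducible (stageObj K ∅ P t₁).hom :=
          inferInstanceAs (GeometricallyIrreducible (pullback.snd P.hom ((baseDiagram T K ∅).obj t₁).hom))
        exact geometricallyConnected_of_geometricallyIrreducible' _ }
  let ψ : ↥(sub T K t₁.unop.1) →ₐ[k] K := (sub T K t₁.unop.1).val.restrictScalars _
  -- the fibre along `ψ` is `(Y_{t₁})_K ≅ Y_K ≅ A` (group structure induced by base change on the left, `A`'s on the right)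
  letI : GrpObj ((legPullback T K ∅ t₁).obj (stageObj K ∅ P t₁)) :=
    Functor.grpObjObj (F := legPullback T K ∅ t₁) (G := stageObj K ∅ P t₁)
  haveI : IsMonHom (legFacObjIso K ∅ t₁ P).hom := hiso
  let eX' : (legPullback T K ∅ t₁).obj (stageObj K ∅ P t₁) ≅ XA := legFacObjIso K ∅ t₁ P ≪≫ e₁.symm
  haveI hmonE : IsMonHom eX'.hom := by
    change IsMonHom ((legFacObjIso K ∅ t₁ P).hom ≫ e₁.inv)
    infer_instance
  let eX : (𝒜.fibre ψ.toRingHom).X ≅ A.X := eX'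
  haveI : IsMonHom eX.hom := hmonE
  let e : 𝒜.fibre ψ.toRingHom ≅ A := InducedCategory.isoMk (Grp.mkIso' eX)
  refine ⟨↥(sub T K t₁.unop.1), inferInstance, inferInstance, inferInstance,
    Algebra.FiniteType.trans (S := T) inferInstance inferInstance, ψ, Subtype.val_injective, 𝒜, hcomm, ?_, ⟨e⟩⟩
  haveI := smoothOfRelativeDimension_isStableUnderBaseChange (n := A.dim)
  change SmoothOfRelativeDimension A.dim (pullback.snd P.hom ((baseDiagram T K ∅).obj t₁).hom)
  exact MorphismProperty.pullback_snd _ _ hsm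

/-- **The spread, forgetting commutativity**: an abelian scheme `𝒜/T′` over a finitely generated `k`-domain `T′ ↪ K` of
relative dimension `dim A` with `𝒜_ψ ≅ A` (the shape A-p14's F3/F5 consume when commutativity of the descended group law is not
used; corollary of `exists_abelianScheme_relDim_fibre_iso`). [cite: EGAIV3, Thm. 8.8.2 and Thm. 8.10.5]
[cite: Milne1986AbelianVarieties, §20 Rem. 20.9] -/
theorem exists_abelianScheme_fibre_iso {k : Type u} [Field k] [PerfectField k] {K : Type u} [Field K]
    [Algebra k K] (A : AbelianVariety K) :
    ∃ (T' : Type u) (_ : CommRing T') (_ : IsDomain T') (_ : Algebra k T') (_ : Algebra.FiniteType k T')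
      (ψ : T' →ₐ[k] K) (_ : Function.Injective ψ) (𝒜 : AbelianScheme T'),
      𝒜.IsOfRelDim A.dim ∧ Nonempty (𝒜.fibre ψ.toRingHom ≅ A) := by
  obtain ⟨T', _, _, _, _, ψ, hψ, 𝒜, -, hdim, he⟩ := exists_abelianScheme_relDim_fibre_iso (k := k) A
  exact ⟨T', inferInstance, inferInstance, inferInstance, inferInstance, ψ, hψ, 𝒜, hdim, he⟩

end Literature.AlgebraicGeometry.AbelianSchemes.AbelianScheme

end
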